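import Summits.QuantumFields.BalabanUV.Beta.FP.SliceContactChart
import Summits.QuantumFields.BalabanUV.Beta.FP.SliceBiStencilReflection

/-!
# `BalabanUV.Beta.FP.SliceBiContactChart` — road «FP», binder row D1, sub-row **H2-ASM-5a (Kcov)**, module R8: **THE SLICE BI-TABLE'S REFLECTION CONTACT IS THE
# EXPONENTIAL-CHART CONTACT, WITH NO REMAINDER** — `sliceCtW = conjW ddKer (sliceA κ u) (sliceA κ′ u′) X X′ X₂` with the diagonal generators `X = diagK (−ctGen)` of R7 and
# the SECOND-ORDER GENERATOR `X₂ = ½(X∘X′ + X′∘X)` (the quadratic term of `Ad(e^{A}) = 1 + ad A + ½ (ad A)² + …`)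

HONEST DEPENDENCY (page 1, mandatory): continuum YM on T⁴ ⇐ BetaPertH ∧ nine spine estimates (0/9 proved); BetaPertH ⇐ (D1) ∧ (D4) ∧ CAP+tail;
G-an2-4 gates asym, D1 and NE2/3/4.  HONEST FRAMING (cell contract, verbatim): «discharging `BetaPertH` makes Bałaban's UV stability UNCONDITIONAL —
a real constructive-QFT result; it is NOT the continuum limit and NOT the Clay problem.»  THIS MODULE DISCHARGES NOTHING of the wall: finite indicator algebra over
EXPLICIT tree objects (`SliceBiStencilReflection.sliceCtW` p254164, `SliceVertex.sEntry ∕ sliceA`, `SliceGaugeLaw.ddKer`, an2's `BorderedHessian.diagK ∕ ctGen`, an5's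
`ChartConjugation.conjW₁ ∕ conjW₂ ∕ conjW`) — their closed forms BY NAME; 0 def, 0 `def … : Prop`, nothing cited, 0 sorry; 0∕4 row-D1 binders.  Predicted and certified
first in exact rational arithmetic (`HOME/b2b-balaban-beta-d1-formalise-leaf-02/g10/check_chart2.py`: 0∕656 mismatches; every other multiple of `X∘X′ + X′∘X` fails at the
coincident bond pair).  NOT the (Kcov) instance (the `S∞` share and the orientation pin N-d1leaf02g9-1 remain), NOT H2V-4, NOT D1, NOT BetaPertH, NOT continuum, NOT Clay.

ABSOLUTE RULE (cell charter, verbatim): «No internally-minted statement may enter as a cited fact. Every hypothesis is either kernel-proved in this package or a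
verbatim quotation of a PUBLISHED theorem with page reference. The manuscript(s) under audit are NOT citable for their own disputed steps — they are the thing
under adjudication; programme-internal (2001/route/tribunal) claims are never citable.»

CONTENT.  §1 generic: `diagK_comp_diagK`, `conjW₁_diagK_apply`, `conjW₂_diagK_apply` (**`conjW₂ M (diagK g) (diagK g′) (diagK (g·g′)) x z a b =
M x z a b · (g x a − g z b) · (g′ x a − g′ z b)`**), `conjW_diagK_apply`, `half_anticomm_diagK` (`½(X∘X′ + X′∘X) = diagK (g·g′)`).  §2 the slice's indicator algebra:
pin evaluations of `sEntry` and `ddKer`, the expansion of the law's bond-coincidence coefficient.  §3 **`sliceCtW_eq_conjW`**: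
`sliceCtW 3 α κ u κ′ u′ = conjW ddKer (sliceA 3 κ u) (sliceA 3 κ′ u′) (diagK (−ctGen 3 α L κ u)) (diagK (−ctGen 3 α L κ′ u′)) (diagK (ctGen … κ u · ctGen … κ′ u′))`,
and the law p254164 in (Wr-conj) form **`sliceW_bref_conj`**.
Provenance: D1 formalisation swarm seat b2b-balaban-beta-d1-formalise-leaf-02 gen 10 (road FP engine lineage; sub-row H2-ASM-5a (Kcov)), 2026-08-21.
-/

noncomputable section

namespace Summit.QuantumFields.BalabanUV.Beta.FP.SliceBiContactChart

open Finset
open scoped BigOperators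
open Literature.MathematicalPhysics.QuantumFieldTheory.Balaban1983to89
open Literature.MathematicalPhysics.QuantumFieldTheory.Balaban1983to89.Beta
open AffineAveraging (unitVec dz codiff₁)
open KKTFluctuationKernel (delta1 delta1_apply)
open ExpKernelCalculus (MKer Site comp)
open KernelReflection (refK)
open PolarizationSign (reflSign)
open ResolventReflection (bref Φ)
open OneStepResolventKernel (Fib)
open Summit.QuantumFields.BalabanUV.Beta.ChartConjugation (conjV conjW₁ conjW₂ conjW)
open Summit.QuantumFields.BalabanUV.Beta.BorderedHessian (diagK diagK_apply ctGen ctGen_inl comp_diagK_right comp_diagK_left conjV_diagK_apply)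
open Summit.QuantumFields.BalabanUV.Beta.WilsonReflectionContact (unitVec_eq)
open Summit.QuantumFields.BalabanUV.Beta.FP.SliceVertex (sEntry sEntry_apply sliceA sliceA_inl_inl)
open Summit.QuantumFields.BalabanUV.Beta.FP.SliceVertexReflection (dz_codiff₁_delta1_apply dz_codiff₁_delta1_symm)
open Summit.QuantumFields.BalabanUV.Beta.FP.SliceGaugeLaw (ddKer ddKer_inl_inl_eq_dz_codiff₁ ddKer_inl_inr ddKer_inr_inl ddKer_inr_inr)
open Summit.QuantumFields.BalabanUV.Beta.FP.SliceBiStencil (sliceW)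
open Summit.QuantumFields.BalabanUV.Beta.FP.SliceBiStencilReflection (sliceCtW sliceCtW_inl_inl sliceW_bref)

/-! ## §1 Chart contacts with diagonal generators, entrywise -/

section Diagonal

variable {d : ℕ}

/-- [folklore] the composition of two diagonal kernels is the diagonal kernel of the pointwise product. -/
theorem diagK_comp_diagK (g g' : (Fin (d + 1) → ℤ) → Fib d → ℝ) :
    comp (diagK g) (diagK g') = diagK (fun x a => g x a * g' x a) := by
  funext x z a b
  rw [comp_diagK_right, diagK_apply, diagK_apply]
  split_ifs with h
  · rw [h.1, h.2]
  · rw [zero_mul]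

/-- [folklore] `½ (X∘X′ + X′∘X) = diagK (g·g′)` for diagonal `X = diagK g`, `X′ = diagK g′`. -/
theorem half_anticomm_diagK (g g' : (Fin (d + 1) → ℤ) → Fib d → ℝ) :
    (1 / 2 : ℝ) • (comp (diagK g) (diagK g') + comp (diagK g') (diagK g)) = diagK (fun x a => g x a * g' x a) := by
  rw [diagK_comp_diagK, diagK_comp_diagK]
  funext x z a b
  simp only [Pi.smul_apply, Pi.add_apply, smul_eq_mul, diagK_apply]
  split_ifs <;> ring

/-- [folklore] the first-order piece of the second-order chart contact with diagonal generators, entrywise. -/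
theorem conjW₁_diagK_apply (V Vp : MKer (d + 1) (Fib d)) (g g' : (Fin (d + 1) → ℤ) → Fib d → ℝ) (x z : Fin (d + 1) → ℤ) (a b : Fib d) :
    conjW₁ V Vp (diagK g) (diagK g') x z a b = Vp x z a b * (g z b - g x a) + V x z a b * (g' z b - g' x a) := by
  unfold conjW₁
  simp only [Pi.add_apply, Pi.sub_apply, comp_diagK_right, comp_diagK_left]
  ring

/-- [folklore] **THE QUADRATIC PIECE WITH DIAGONAL GENERATORS AND `X₂ = diagK (g·g′)`, ENTRYWISE**:
`conjW₂ M (diagK g) (diagK g′) (diagK (g·g′)) x z a b = M x z a b · (g x a − g z b) · (g′ x a − g′ z b)`. -/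
theorem conjW₂_diagK_apply (M : MKer (d + 1) (Fib d)) (g g' : (Fin (d + 1) → ℤ) → Fib d → ℝ) (x z : Fin (d + 1) → ℤ) (a b : Fib d) :
    conjW₂ M (diagK g) (diagK g') (diagK (fun y c => g y c * g' y c)) x z a b = M x z a b * (g x a - g z b) * (g' x a - g' z b) := by
  unfold conjW₂
  simp only [Pi.add_apply, Pi.sub_apply, diagK_comp_diagK, comp_diagK_right, comp_diagK_left]
  ring

/-- [folklore] the whole second-order chart contact with diagonal generators, entrywise. -/
theorem conjW_diagK_apply (M V Vp : MKer (d + 1) (Fib d)) (g g' : (Fin (d + 1) → ℤ) → Fib d → ℝ) (x z : Fin (d + 1) → ℤ) (a b : Fib d) :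
    conjW M V Vp (diagK g) (diagK g') (diagK (fun y c => g y c * g' y c)) x z a b =
      Vp x z a b * (g z b - g x a) + V x z a b * (g' z b - g' x a) + M x z a b * (g x a - g z b) * (g' x a - g' z b) := by
  unfold conjW
  rw [Pi.add_apply, Pi.add_apply, Pi.add_apply, Pi.add_apply, conjW₁_diagK_apply, conjW₂_diagK_apply]

end Diagonal

/-! ## §2 The slice's indicator algebra -/

section Slice

variable (α κ κ' : Fin 4) (u u' : Site 4)

/-- [our object] the field leg of the NEGATED product-chart generator: `−ctGen x (inl c) = [x = u ∧ c = κ ∧ κ = α]`. -/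
theorem neg_ctGen_inl (L : ℕ) (x : Site 4) (c : Fin 4) : -ctGen 3 α L κ u x (Sum.inl c) = (if x = u ∧ c = κ ∧ κ = α then (1 : ℝ) else 0) := by
  rw [ctGen_inl]; split_ifs <;> norm_num

/-- [folklore] the generator's indicator splits off the axis condition. -/
theorem ind_pin_axis (x : Site 4) (c : Fin 4) : (if x = u ∧ c = κ ∧ κ = α then (1 : ℝ) else 0) = (if x = u ∧ c = κ then (1 : ℝ) else 0) * (if κ = α then (1 : ℝ) else 0) := by
  by_cases h : x = u ∧ c = κ <;> by_cases hk : κ = α <;> simp [h, hk]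

/-- [folklore] two pins at the SAME leg merge: `[x = u ∧ a = κ]·[x = u′ ∧ a = κ′] = [x = u ∧ a = κ]·[u = u′ ∧ κ = κ′]`. -/
theorem pin_mul_pin (x : Site 4) (a : Fin 4) : (if x = u ∧ a = κ then (1 : ℝ) else 0) * (if x = u' ∧ a = κ' then (1 : ℝ) else 0) = (if x = u ∧ a = κ then (1 : ℝ) else 0) * (if u = u' ∧ κ = κ' then (1 : ℝ) else 0) := by
  by_cases h : x = u ∧ a = κ
  · obtain ⟨rfl, rfl⟩ := h; rfl
  · simp [h]

/-- [folklore] `[κ′ = α]·[u = u′ ∧ κ = κ′] = [κ = α]·[u = u′ ∧ κ = κ′]`. -/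
theorem axis_mul_diag : (if κ' = α then (1 : ℝ) else 0) * (if u = u' ∧ κ = κ' then (1 : ℝ) else 0) = (if κ = α then (1 : ℝ) else 0) * (if u = u' ∧ κ = κ' then (1 : ℝ) else 0) := by
  by_cases h : u = u' ∧ κ = κ'
  · obtain ⟨-, rfl⟩ := h; rfl
  · simp [h]

/-- [folklore] indicators are idempotent. -/
theorem ind_mul_self (p : Prop) [Decidable p] : (if p then (1 : ℝ) else 0) * (if p then (1 : ℝ) else 0) = (if p then (1 : ℝ) else 0) := by
  split_ifs <;> norm_num

/-- [folklore] **COLUMN PIN OF A SLICE ENTRY AT ANOTHER LEG** (evaluation): `s_{κ′,u′}(x,a;z,b)·[z = v ∧ b = μ] =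
−2·[x = u′ ∧ a = κ′]·[z = v ∧ b = μ]·([v = u′ + e_{κ′}] − [v + e_μ = u′ + e_{κ′}])`. -/
theorem sEntry_mul_pin_col (μ : Fin 4) (v x z : Site 4) (a b : Fin 4) :
    sEntry 3 κ' u' x z a b * (if z = v ∧ b = μ then (1 : ℝ) else 0) =
      -2 * (if x = u' ∧ a = κ' then (1 : ℝ) else 0) * (if z = v ∧ b = μ then (1 : ℝ) else 0) * ((if v = u' + unitVec κ' then (1 : ℝ) else 0) - (if v + unitVec μ = u' + unitVec κ' then (1 : ℝ) else 0)) := by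
  rw [sEntry_apply]
  simp only [← unitVec_eq]
  by_cases h : z = v ∧ b = μ
  · obtain ⟨rfl, rfl⟩ := h
    have e : (z = u' + unitVec κ' - unitVec b) ↔ (z + unitVec b = u' + unitVec κ') := eq_sub_iff_add_eq
    simp only [e, and_self, if_true]
    split_ifs <;> ring
  · simp [h]

/-- [folklore] **ROW PIN OF A SLICE ENTRY** (absorption into the entry's own pin): `s_{κ,u}(x,a;z,b)·[x = u′ ∧ a = κ′] = [u = u′ ∧ κ = κ′]·s_{κ,u}(x,a;z,b)`. -/
theorem sEntry_mul_pin_row (x z : Site 4) (a b : Fin 4) :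
    sEntry 3 κ u x z a b * (if x = u' ∧ a = κ' then (1 : ℝ) else 0) = (if u = u' ∧ κ = κ' then (1 : ℝ) else 0) * sEntry 3 κ u x z a b := by
  rw [sEntry_apply]
  by_cases h : x = u ∧ a = κ
  · obtain ⟨rfl, rfl⟩ := h
    simp only [and_self, if_true]
    ring
  · have h0 : (if x = u ∧ a = κ then (1 : ℝ) else 0) = 0 := if_neg h
    by_cases h' : x = u' ∧ a = κ'
    · obtain ⟨rfl, rfl⟩ := h'
      have h'' : ¬(u = x ∧ κ = a) := fun hh => h ⟨hh.1.symm, hh.2.symm⟩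
      simp [h, h'']
    · simp [h, h']

/-- [folklore] **ROW PIN OF THE OTHER FAMILY'S ENTRY**: `s_{κ′,u′}(x,a;z,b)·[x = u ∧ a = κ] = [u = u′ ∧ κ = κ′]·s_{κ,u}(x,a;z,b)`. -/
theorem sEntry'_mul_pin_row (x z : Site 4) (a b : Fin 4) :
    sEntry 3 κ' u' x z a b * (if x = u ∧ a = κ then (1 : ℝ) else 0) = (if u = u' ∧ κ = κ' then (1 : ℝ) else 0) * sEntry 3 κ u x z a b := by
  rw [sEntry_apply, sEntry_apply]
  by_cases h : x = u ∧ a = κ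
  · obtain ⟨rfl, rfl⟩ := h
    by_cases h' : x = u' ∧ a = κ'
    · obtain ⟨rfl, rfl⟩ := h'
      simp
    · simp [h']
  · have h1 : ¬(x = u ∧ a = κ) := h
    by_cases hD : u = u' ∧ κ = κ'
    · obtain ⟨rfl, rfl⟩ := hD
      simp [h1]
    · simp [h1, hD]

/-- [folklore] **TWO PINS ON THE `d d*` FORM** (evaluation): `dd(x,a;z,b)·[x = u ∧ a = κ]·[z = u′ ∧ b = κ′] =
[x = u ∧ a = κ]·[z = u′ ∧ b = κ′]·([u + e_κ = u′ + e_{κ′}] − [u′ = u + e_κ] − [u = u′ + e_{κ′}] + [u = u′])`. -/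
theorem ddKer_mul_pins (x z : Site 4) (a b : Fin 4) :
    ddKer x z (Sum.inl a) (Sum.inl b) * (if x = u ∧ a = κ then (1 : ℝ) else 0) * (if z = u' ∧ b = κ' then (1 : ℝ) else 0) =
      (if x = u ∧ a = κ then (1 : ℝ) else 0) * (if z = u' ∧ b = κ' then (1 : ℝ) else 0) *
        ((if u + unitVec κ = u' + unitVec κ' then (1 : ℝ) else 0) - (if u' = u + unitVec κ then (1 : ℝ) else 0) - (if u = u' + unitVec κ' then (1 : ℝ) else 0) + (if u = u' then (1 : ℝ) else 0)) := by
  by_cases h : x = u ∧ a = κ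
  · by_cases h' : z = u' ∧ b = κ'
    · obtain ⟨rfl, rfl⟩ := h
      obtain ⟨rfl, rfl⟩ := h'
      rw [ddKer_inl_inl_eq_dz_codiff₁, dz_codiff₁_delta1_apply]
      have e1 : (x + unitVec a - unitVec b = z) ↔ (x + unitVec a = z + unitVec b) := sub_eq_iff_eq_add
      have e2 : (x + unitVec a = z) ↔ (z = x + unitVec a) := eq_comm
      have e3 : (x - unitVec b = z) ↔ (x = z + unitVec b) := sub_eq_iff_eq_add
      simp only [e1, e2, e3, and_self, if_true]
      ring
    · simp [h']
  · simp [h]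

/-- [folklore] **THE LAW'S BOND-COINCIDENCE COEFFICIENT, EXPANDED BY AXIS CASES**: with `k = [κ = α]`, `k′ = [κ′ = α]`, `c₁ = [u + e_κ = u′ + e_{κ′}]`,
`E₁ = [u = u′ + e_{κ′}]`, `F₁ = [u′ = u + e_κ]`, `U = [u = u′]`:
`[u + e_κ + k′e_α = u′ + e_{κ′} + k e_α] = c₁ + k(E₁ − c₁) + k′(F₁ − c₁) + k k′(c₁ − F₁ − E₁ + U)`. -/
theorem coincidence_expand :
    (if u + unitVec κ + (if κ' = α then unitVec α else 0) = u' + unitVec κ' + (if κ = α then unitVec α else 0) then (1 : ℝ) else 0) =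
      (if u + unitVec κ = u' + unitVec κ' then (1 : ℝ) else 0) + (if κ = α then (1 : ℝ) else 0) * ((if u = u' + unitVec κ' then (1 : ℝ) else 0) - (if u + unitVec κ = u' + unitVec κ' then (1 : ℝ) else 0))
        + (if κ' = α then (1 : ℝ) else 0) * ((if u' = u + unitVec κ then (1 : ℝ) else 0) - (if u + unitVec κ = u' + unitVec κ' then (1 : ℝ) else 0))
        + (if κ = α then (1 : ℝ) else 0) * (if κ' = α then (1 : ℝ) else 0) *
          ((if u + unitVec κ = u' + unitVec κ' then (1 : ℝ) else 0) - (if u' = u + unitVec κ then (1 : ℝ) else 0) - (if u = u' + unitVec κ' then (1 : ℝ) else 0) + (if u = u' then (1 : ℝ) else 0)) := by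
  by_cases hk : κ = α
  · subst hk
    by_cases hk' : κ' = κ
    · subst hk'
      have e : (u + unitVec κ' + unitVec κ' = u' + unitVec κ' + unitVec κ') ↔ (u = u') := by rw [add_left_inj, add_left_inj]
      simp only [e, if_true]
      ring
    · have e : (u + unitVec κ + 0 = u' + unitVec κ' + unitVec κ) ↔ (u = u' + unitVec κ') := by rw [add_zero, add_left_inj]
      simp only [e, hk', if_true, if_false]
      ring
  · by_cases hk' : κ' = α
    · subst hk'
      have e : (u + unitVec κ + unitVec κ' = u' + unitVec κ' + 0) ↔ (u' = u + unitVec κ) := by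
        rw [add_zero, add_left_inj]; exact eq_comm
      simp only [e, hk, if_true, if_false]
      ring
    · simp only [hk, hk', if_false, add_zero]
      ring

end Slice

/-! ## §3 The headline -/

/-- [our object] **THE SLICE BI-TABLE'S REFLECTION CONTACT IS THE EXPONENTIAL-CHART CONTACT, NO REMAINDER**: for every axis `α`, window `L` and bond pair,
`sliceCtW 3 α κ u κ′ u′ = conjW ddKer (sliceA 3 κ u) (sliceA 3 κ′ u′) X X′ X₂` with `X = diagK (−ctGen 3 α L κ u)`, `X′ = diagK (−ctGen 3 α L κ′ u′)` and
`X₂ = diagK (ctGen … κ u · ctGen … κ′ u′)` (`= ½(X∘X′ + X′∘X)`, `half_anticomm_diagK`). -/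
theorem sliceCtW_eq_conjW (α : Fin 4) (L : ℕ) (κ : Fin 4) (u : Site 4) (κ' : Fin 4) (u' : Site 4) :
    sliceCtW 3 α κ u κ' u' =
      conjW ddKer (sliceA 3 κ u) (sliceA 3 κ' u') (diagK (fun y c => -ctGen 3 α L κ u y c)) (diagK (fun y c => -ctGen 3 α L κ' u' y c))
        (diagK (fun y c => ctGen 3 α L κ u y c * ctGen 3 α L κ' u' y c)) := by
  have hX₂ : (fun y c => ctGen 3 α L κ u y c * ctGen 3 α L κ' u' y c) =
      (fun y c => (fun y c => -ctGen 3 α L κ u y c) y c * (fun y c => -ctGen 3 α L κ' u' y c) y c) := by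
    funext y c; ring
  rw [hX₂]
  funext x z a b
  rw [conjW_diagK_apply]
  rcases a with a | i <;> rcases b with b | j
  · -- the field–field block
    rw [sliceCtW_inl_inl, sliceA_inl_inl, sliceA_inl_inl, neg_ctGen_inl, neg_ctGen_inl, neg_ctGen_inl, neg_ctGen_inl,
      ind_pin_axis, ind_pin_axis, ind_pin_axis, ind_pin_axis, delta1_apply, delta1_apply,
      ← dz_codiff₁_delta1_symm a b x z, ← ddKer_inl_inl_eq_dz_codiff₁, coincidence_expand]
    have hPz : (if b = κ ∧ z = u then (1 : ℝ) else 0) = (if z = u ∧ b = κ then (1 : ℝ) else 0) := by simp only [and_comm]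
    have hP : (if a = κ ∧ x = u then (1 : ℝ) else 0) = (if x = u ∧ a = κ then (1 : ℝ) else 0) := by simp only [and_comm]
    rw [hPz, hP]
    -- the eight pin evaluations of the slice entries, the four of the `d d*` form, pin merging, axis bookkeeping
    have f1 := sEntry_mul_pin_col κ' u' κ u x z a b
    have f4 := sEntry_mul_pin_col κ' u' κ u z x b a
    have f5 := sEntry_mul_pin_col κ u κ' u' x z a b
    have f8 := sEntry_mul_pin_col κ u κ' u' z x b a
    have f2 := sEntry'_mul_pin_row κ κ' u u' x z a b
    have f3 := sEntry'_mul_pin_row κ κ' u u' z x b a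
    have f6 := sEntry_mul_pin_row κ κ' u u' x z a b
    have f7 := sEntry_mul_pin_row κ κ' u u' z x b a
    have m1 := ddKer_mul_pins κ κ' u u' x z a b
    have m2 := ddKer_mul_pins κ' κ u' u x z a b
    have d1 := pin_mul_pin κ κ' u u' x a
    have d2 := pin_mul_pin κ κ' u u' z b
    have kd := axis_mul_diag α κ κ' u u'
    have kk := ind_mul_self (κ = α)
    have hc : (if u' + unitVec κ' = u + unitVec κ then (1 : ℝ) else 0) = (if u + unitVec κ = u' + unitVec κ' then (1 : ℝ) else 0) := by simp only [eq_comm]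
    have hU : (if u' = u then (1 : ℝ) else 0) = (if u = u' then (1 : ℝ) else 0) := by simp only [eq_comm]
    rw [hc, hU] at m2
    rw [hc] at f5 f8
    linear_combination (-(1 / 2 : ℝ) * (if κ = α then (1 : ℝ) else 0)) * f1 + (-(1 / 2 : ℝ) * (if κ = α then (1 : ℝ) else 0)) * f4
      + (-(1 / 2 : ℝ) * (if κ' = α then (1 : ℝ) else 0)) * f5 + (-(1 / 2 : ℝ) * (if κ' = α then (1 : ℝ) else 0)) * f8
      + ((1 / 2 : ℝ) * (if κ = α then (1 : ℝ) else 0)) * f2 + ((1 / 2 : ℝ) * (if κ = α then (1 : ℝ) else 0)) * f3 + ((1 / 2 : ℝ) * (if κ' = α then (1 : ℝ) else 0)) * f6 + ((1 / 2 : ℝ) * (if κ' = α then (1 : ℝ) else 0)) * f7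
      + ((if κ = α then (1 : ℝ) else 0) * (if κ' = α then (1 : ℝ) else 0)) * m1 + ((if κ = α then (1 : ℝ) else 0) * (if κ' = α then (1 : ℝ) else 0)) * m2
      - (ddKer x z (Sum.inl a) (Sum.inl b) * (if κ = α then (1 : ℝ) else 0) * (if κ' = α then (1 : ℝ) else 0)) * d1 - (ddKer x z (Sum.inl a) (Sum.inl b) * (if κ = α then (1 : ℝ) else 0) * (if κ' = α then (1 : ℝ) else 0)) * d2
      + (-(ddKer x z (Sum.inl a) (Sum.inl b) * (if z = u ∧ b = κ then (1 : ℝ) else 0) * (if κ = α then (1 : ℝ) else 0)) - ddKer x z (Sum.inl a) (Sum.inl b) * (if x = u ∧ a = κ then (1 : ℝ) else 0) * (if κ = α then (1 : ℝ) else 0)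
          + (1 / 2 : ℝ) * sEntry 3 κ u z x b a + (1 / 2 : ℝ) * sEntry 3 κ u x z a b) * kd
      + (-(ddKer x z (Sum.inl a) (Sum.inl b) * (if z = u ∧ b = κ then (1 : ℝ) else 0) * (if u = u' ∧ κ = κ' then (1 : ℝ) else 0)) - ddKer x z (Sum.inl a) (Sum.inl b) * (if x = u ∧ a = κ then (1 : ℝ) else 0) * (if u = u' ∧ κ = κ' then (1 : ℝ) else 0)) * kk
  · simp [sliceCtW, sliceA, ddKer_inl_inr]
  · simp [sliceCtW, sliceA, ddKer_inr_inl]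
  · simp [sliceCtW, sliceA, ddKer_inr_inr]

/-- [our object] the same identity with the second-order generator written as the anticommutator `X₂ = ½(X∘X′ + X′∘X)` of the first-order ones. -/
theorem sliceCtW_eq_conjW_half (α : Fin 4) (L : ℕ) (κ : Fin 4) (u : Site 4) (κ' : Fin 4) (u' : Site 4) :
    sliceCtW 3 α κ u κ' u' =
      conjW ddKer (sliceA 3 κ u) (sliceA 3 κ' u') (diagK (fun y c => -ctGen 3 α L κ u y c)) (diagK (fun y c => -ctGen 3 α L κ' u' y c))
        ((1 / 2 : ℝ) • (comp (diagK (fun y c => -ctGen 3 α L κ u y c)) (diagK (fun y c => -ctGen 3 α L κ' u' y c))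
          + comp (diagK (fun y c => -ctGen 3 α L κ' u' y c)) (diagK (fun y c => -ctGen 3 α L κ u y c)))) := by
  rw [half_anticomm_diagK]
  have e : (fun y c => (fun y c => -ctGen 3 α L κ u y c) y c * (fun y c => -ctGen 3 α L κ' u' y c) y c) =
      (fun y c => ctGen 3 α L κ u y c * ctGen 3 α L κ' u' y c) := by
    funext y c; ring
  rw [e]
  exact sliceCtW_eq_conjW α L κ u κ' u'

/-- [our object] **THE REFLECTION LAW OF THE BF SLICE BI-TABLE IN (Wr-conj) FORM** — `SliceBiStencilReflection.sliceW_bref` (p254164) re-read with §3: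
`sliceW 3 κ (bref α κ u) κ′ (bref α κ′ u′) = (ε_κ ε_{κ′}) • refK (Φ N α) (sliceW 3 κ u κ′ u′ + conjW ddKer (sliceA 3 κ u) (sliceA 3 κ′ u′) X X′ X₂)` — chart inverse
`ddKer`, the negated product-chart generators, `X₂ = diagK (ctGen·ctGen′)`, NO remainder; for every blocking `N` and window `L`. -/
theorem sliceW_bref_conj (N L : ℕ) (α κ : Fin 4) (u : Site 4) (κ' : Fin 4) (u' : Site 4) :
    sliceW 3 κ (bref α κ u) κ' (bref α κ' u') = (reflSign α κ * reflSign α κ') • refK (Φ N α)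
      (sliceW 3 κ u κ' u' + conjW ddKer (sliceA 3 κ u) (sliceA 3 κ' u') (diagK (fun y c => -ctGen 3 α L κ u y c))
        (diagK (fun y c => -ctGen 3 α L κ' u' y c)) (diagK (fun y c => ctGen 3 α L κ u y c * ctGen 3 α L κ' u' y c))) := by
  rw [← sliceCtW_eq_conjW]
  exact sliceW_bref N α κ u κ' u'

end Summit.QuantumFields.BalabanUV.Beta.FP.SliceBiContactChart

end
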